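import Summits.QuantumFields.BalabanUV.Beta.FP.PerfectRepBasePoint
import Summits.QuantumFields.BalabanUV.Beta.FP.PerfectColumnKronecker
import Summits.QuantumFields.BalabanUV.Beta.D1BFx.MomentTransferKroneckerWard

/-!
# `BalabanUV.Beta.FP.PerfectSandwichWard` — road «FP» for binder row D1, supplier row «hT1-from-reflection» (owner ruling R-FP-8 (2)),
# ROOTING-INDEPENDENT HALF, part 2: THE REP∞ ENDs of `PerfectFullSandwich` ∕ `PerfectRepBasePoint` RE-POINTED AT THE ROAD'S ENTRY
# `(κ, λ) ∈ {μ, ν}²` with `hT1` REPLACED BY FIRST-BOND DIVERGENCE-FREENESS of the full fine kernel — no reflection law, no rooting hypothesis;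
# at the perfect resolvent every K-side hypothesis INCLUDING the Kronecker first-moment row is discharged from the tree

HONEST DEPENDENCY (page 1, mandatory): continuum YM on T⁴ ⇐ BetaPertH ∧ nine spine estimates (0/9 proved); BetaPertH ⇐ (D1) ∧ (D4) ∧
CAP+tail; G-an2-4 gates asym, D1 and NE2/3/4.  HONEST FRAMING (cell contract, verbatim): «discharging `BetaPertH` makes Bałaban's UV
stability UNCONDITIONAL — a real constructive-QFT result; it is NOT the continuum limit and NOT the Clay problem.»  THIS MODULE DISCHARGES
NOTHING of D1 / BetaPertH: [folklore] bookkeeping BY NAME over this lineage's `FP/PerfectBubbleSandwich` ∕ `PerfectFullSandwich` ∕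
`PerfectRepBasePoint` (gen 3), `FP/PerfectColumnKronecker` + `D1BFx/MomentTransferKronecker(Ward)` (gen 4), leaf-06/owner's `StepLawKHolds` ∕
`SymmetryK`.  No `def`, no `Prop` mirror, no cited fact, 0 sorry; every class / covariance / Ward datum of the stencils and tables is a HYPOTHESIS
displayed in the signature; 0 wall binders; NOT hrep (LEGS ∕ TAILS ∕ GERM ∕ N3-fine open), NOT D1, NOT BetaPertH, NOT continuum, NOT Clay.

ABSOLUTE RULE (cell charter, verbatim): «No internally-minted statement may enter as a cited fact. Every hypothesis is either
kernel-proved in this package or a verbatim quotation of a PUBLISHED theorem with page reference. The manuscript(s) under audit are NOT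
citable for their own disputed steps — they are the thing under adjudication; programme-internal (2001/route/tribunal) claims are never
citable.»

WHY.  `PerfectFullSandwich.secondMoment_TPerfOf_perfect_eq` ∕ `PerfectRepBasePoint.secondMoment_TPerfOf_perfect_eq_basePoint` (the REP∞ files of
record; the first twelve binders of the owner's seam `FP/RepSeam.hrep_perfect_of_rows`) carry `hrow` (Ward rows) and `hT1` (ALL base-point-summed
first moments) of the full fine kernel `fineHessA (Π K Π) (Πᵀ S) Wf`.  `hT1`'s only supplier was a reflection covariance the corner-rooted `Π` of
record does not have (leaf-02-g3 caution CLAIMS 2026-08-20T13:55:25Z; an5 `CornerRootInstance`).  At the road's entry `(κ, λ) = (μ, ν)` —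
`B12Beta.secondMoment`'s shape `Σ_x P_{μν}(x)·x_μ·x_ν` ([Balaban1987RG1] (1.22), «μ ≠ ν arbitrary») — BOTH are replaced here by ONE datum:
FIRST-BOND DIVERGENCE-FREENESS `Σ_c (P c e (u − e_c) u' − P c e u u') = 0` of the full fine kernel (rows∕columns zero AND the diagonal first moments
zero follow — `MomentTransferKroneckerWard`; the remaining cross terms die by the KRONECKER first-moment row of the column, PROVED for the perfect
column in `PerfectColumnKronecker`, and by the Hessian symmetry `fineHessA_transpose`).  First-bond divergence-freeness is EXACTLY what leaf-01's
`FineHessianWard.divFree_fineHessA_of_wardLaws` produces from the jet-level Ward laws (W1)∕(W2) (an2's `KernelWard.ward_hess`); its `unitVec`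
spelling converts by `PerfectColumnKronecker.divFree_single_of_unitVec`.  So after this module the REP∞ chain's inputs at the road's entry are
{N3-fine Ward laws} ∪ {proved column rows} — no parity, no rooting; the skeleton's risk (r6) «hT1 rides with (R45)» does not touch `(κ, λ) = (μ, ν)`.

CONTENT (all [folklore] / [our object]): **`bondSecondMoment_TPerfOf_eq_avgM2_of_divFree`** (generic decaying coarse-invariant `K` with
`EntryHyps` letters + Kronecker row; `κ, λ ∈ {μ, ν}`), `secondMoment_TPerfOf_vertex2OfK_eq_of_divFree` (`secondMoment` currency, `n⁻⁸` displayed),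
**`secondMoment_TPerfOf_perfect_eq_of_divFree`** (`K := KPerf …`, K-side hypothesis-free), **`secondMoment_TPerfOf_perfect_eq_basePoint_of_divFree`**
(the `_avg` END's `hrep` currency).  Unit `b2b-balaban-beta-d1-formalise-leaf-02` (gen 4).
-/

noncomputable section

namespace Summit.QuantumFields.BalabanUV.Beta.FP.PerfectSandwichWard

open Finset Filter Topology
open scoped BigOperators
open Literature.MathematicalPhysics.QuantumFieldTheory.Balaban1983to89
open Literature.MathematicalPhysics.QuantumFieldTheory.Balaban1983to89.Beta
open DecimatedMomentSummable (ConstReproSum LinReproSum AbsMoment₂)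
open DressedMomentNormalisation (EKer resSite EntryHyps)
open ExpKernelCalculus (Site MKer Decays BiLoc shiftK)
open OneStepResolventKernel (Fib LocStencil)
open OneStepKernelFamily (colH)
open AxialProjector (coProj)
open AxialDressing (axDressK decays_axDressK locStencil_coProj cN')
open SecondOrderResponse (vertex2OfK)
open WindowIdentification (fullSum)
open DyadicShell (Pt toReal)
open Summit.QuantumFields.BalabanUV.Beta.TameKernelCalculus
open Summit.QuantumFields.BalabanUV.Beta.GAN24.CombesThomas (sfStep smStep)
open Summit.QuantumFields.BalabanUV.Beta.D1BFx.MomentTransferPeriodic (Ker₂ IsBlockPeriodic baseKer)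
open Summit.QuantumFields.BalabanUV.Beta.D1BFx.MomentTransferPeriodicEntry (EKer₂ dressedEntryP avgM2)
open Summit.QuantumFields.BalabanUV.Beta.D1BFx.MomentTransferKroneckerWard (bondSecondMomentP_tsum_four_of_divFree)
open Summit.QuantumFields.BalabanUV.Beta.D1BFx.ReducedKernelSandwichLeg (fineHessA fineHessA_transpose absMoment₂_baseKer_fineHessA)
open Summit.QuantumFields.BalabanUV.Beta.FP.PerfectObjectsT (KPerf TPerfOf)
open Summit.QuantumFields.BalabanUV.Beta.FP.TransportInfinityM (colOf)
open Summit.QuantumFields.BalabanUV.Beta.FP.StepLawKHolds (exists_decays_KPerf_holds)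
open Summit.QuantumFields.BalabanUV.Beta.FP.SymmetryK (shiftK_KPerf)
open Summit.QuantumFields.BalabanUV.Beta.FP.PerfectBubbleSandwich (axDressK_blockCov coProj_translate constReproSum_colH_zero linReproSum_colH_zero
  absMoment₂_colH_zero entryHyps_perfCol_zero)
open Summit.QuantumFields.BalabanUV.Beta.FP.PerfectFullSandwich (isBlockPeriodic_fineHessA_coarse TPerfOf_vertex2OfK_eq_dressedEntryP)
open Summit.QuantumFields.BalabanUV.Beta.FP.PerfectRepBasePoint (inv_mul_avgM2_eq_sum_fullSum)
open Summit.QuantumFields.BalabanUV.Beta.FP.PerfectColumnKronecker (linReproSum_kronecker_of_offDiag linReproSum_colH_zero_offDiag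
  linReproSum_perfCol_offDiag_holds)

/-! ## §1 The REP∞ ENDs re-pointed: `hT1` replaced by first-bond divergence-freeness, at the road's entry -/

section Transport

variable {n : ℕ} {K : MKer (3 + 1) (Fib 3)} {C δ : ℝ} {S : Fin (3 + 1) → (Fin (3 + 1) → ℤ) → MKer (3 + 1) (Fib 3)} {Cs δs : ℝ}
  {Wf : Fin (3 + 1) → (Fin (3 + 1) → ℤ) → Fin (3 + 1) → (Fin (3 + 1) → ℤ) → MKer (3 + 1) (Fib 3)} {C2 δ2 : ℝ}

/-- [folklore] **ALG-2b AT THE ENTRIES `κ, λ ∈ {μ, ν}` WITHOUT `hT1`.**  Decaying, coarse-translation-invariant `K` whose column `colOf K` carries the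
`EntryHyps` letters AND the Kronecker first-moment row (`hw1off`); local coarse-covariant `S`; bi-localised coarse-covariant SYMMETRIC `Wf`; the FULL fine
kernel `fineHessA (Π K Π) (Πᵀ S) Wf` DIVERGENCE-FREE IN THE FIRST BOND (`hdiv`): for `κ, λ ∈ {μ, ν}`,
`Σ'_z z_κ z_λ · n⁸ · TPerfOf n K S (vertex2OfK K n Wf) μ ν z = avgM2 n (fineHessA … μ ν) κ λ` — `PerfectFullSandwich.bondSecondMoment_TPerfOf_eq_avgM2`
with `hrow` + `hT1` REPLACED by `hdiv` (+ `hw1off`); no reflection / inversion law, no rooting hypothesis. -/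
theorem bondSecondMoment_TPerfOf_eq_avgM2_of_divFree (hn : 1 ≤ n) (hK : Decays K C δ) (hδ : 0 < δ)
    (hKcov : ∀ t : Fin (3 + 1) → ℤ, shiftK (-((n : ℤ) • t)) K = K)
    (hw0 : ∀ κ l : Fin 4, ConstReproSum n (colOf K κ l) (if κ = l then (((n : ℝ) ^ (4 + 1))⁻¹) else 0))
    (hw1 : ∀ κ l : Fin 4, ∃ C : Fin 4 → ℝ, LinReproSum n (colOf K κ l) C) (hw1off : ∀ κ l : Fin 4, κ ≠ l → LinReproSum n (colOf K κ l) 0)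
    (hwA : ∀ κ l : Fin 4, AbsMoment₂ (colOf K κ l))
    (hS : LocStencil S Cs δs) (hδs : 0 < δs) (hScov : ∀ κ u t, S κ (u + (n : ℤ) • t) = shiftK (-((n : ℤ) • t)) (S κ u))
    (hW : ∀ κ' u l' u', BiLoc (Wf κ' u l' u') u u' C2 δ2) (hδ2 : 0 < δ2)
    (hWcov : ∀ κ' u l' u' t, Wf κ' (u + (n : ℤ) • t) l' (u' + (n : ℤ) • t) = shiftK (-((n : ℤ) • t)) (Wf κ' u l' u'))
    (hWsymm : ∀ (κ' : Fin 4) (u : Site 4) (l' : Fin 4) (u' : Site 4), Wf κ' u l' u' = Wf l' u' κ' u)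
    (hdiv : ∀ (e : Fin 4) (u' u : Site 4), ∑ c : Fin 4,
      (fineHessA (axDressK n K) (coProj n S) Wf c e (u - Pi.single c 1) u' - fineHessA (axDressK n K) (coProj n S) Wf c e u u') = 0)
    {κ lam μ ν : Fin 4} (hκ : κ = μ ∨ κ = ν) (hlam : lam = μ ∨ lam = ν) :
    ∑' z : Site 4, ((z κ * z lam : ℤ) : ℝ) * ((n : ℝ) ^ 8 * TPerfOf n K S (vertex2OfK K n Wf) μ ν z)
      = avgM2 n (fineHessA (axDressK n K) (coProj n S) Wf μ ν) κ lam := by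
  have hA : Spr (axDressK n K) := ⟨_, δ, hδ, decays_axDressK hn hK hδ.le⟩
  have hm : 0 < min δs δ2 := lt_min hδs hδ2
  have hS' : ∀ κ u, BiLoc (coProj n S κ u) u u (|cN' 3 n δs * Cs|) (min δs δ2) := fun κ u =>
    biLoc_of_le (locStencil_coProj hn hS hδs.le κ u) (min_le_left _ _)
  have hW' : ∀ κ' u l' u', BiLoc (Wf κ' u l' u') u u' (|C2|) (min δs δ2) := fun κ' u l' u' =>
    biLoc_of_le (hW κ' u l' u') (min_le_right _ _)
  obtain ⟨C1, hC1⟩ := linReproSum_kronecker_of_offDiag (w := fun c a => colH K n a 0 c)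
    (fun κ' l => linReproSum_colH_zero hw1 κ' l) (fun κ' l h => linReproSum_colH_zero_offDiag hw1off κ' l h)
  have h := bondSecondMomentP_tsum_four_of_divFree (N := n) (by omega) (fun c a => colH K n a 0 c)
    (fineHessA (axDressK n K) (coProj n S) Wf)
    (fun c e => isBlockPeriodic_fineHessA_coarse (axDressK_blockCov hn hKcov) (coProj_translate hn hScov) hWcov c e)
    (fun c e s s' => fineHessA_transpose (axDressK n K) hA hS' hm hWsymm c e s s') hdiv
    (fun κ' l => constReproSum_colH_zero (σ := fun κ' l => if κ' = l then (((n : ℝ) ^ (4 + 1))⁻¹) else 0) hw0 κ' l)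
    hC1 (fun κ' l => absMoment₂_colH_zero hwA κ' l)
    (fun c e b => absMoment₂_baseKer_fineHessA (axDressK n K) hA hS' hW' hm c e b) hκ hlam
  rw [← h, ← (Equiv.neg (Site 4)).tsum_eq]
  refine tsum_congr fun z => ?_
  rw [TPerfOf_vertex2OfK_eq_dressedEntryP hn hK hδ hKcov hwA hS hδs hScov hW hδ2 hWcov μ ν]
  simp only [Equiv.neg_apply, Pi.neg_apply, neg_mul_neg, neg_neg]

/-- [folklore] The same in `B12Beta.secondMoment` currency, AT THE ROAD'S ENTRY `(κ, λ) = (μ, ν)` — EXACTLY the shape `Σ_x P_{μν}(x)·x_μ·x_ν` of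
(1.22): `Σ'_z T μ ν z · z_μ · z_ν = n⁻⁸ · avgM2 n (fineHessA (Π K Π) (Πᵀ S) Wf μ ν) μ ν`, with `hrow` + `hT1` REPLACED by `hdiv`. -/
theorem secondMoment_TPerfOf_vertex2OfK_eq_of_divFree (hn : 1 ≤ n) (hK : Decays K C δ) (hδ : 0 < δ)
    (hKcov : ∀ t : Fin (3 + 1) → ℤ, shiftK (-((n : ℤ) • t)) K = K)
    (hw0 : ∀ κ l : Fin 4, ConstReproSum n (colOf K κ l) (if κ = l then (((n : ℝ) ^ (4 + 1))⁻¹) else 0))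
    (hw1 : ∀ κ l : Fin 4, ∃ C : Fin 4 → ℝ, LinReproSum n (colOf K κ l) C) (hw1off : ∀ κ l : Fin 4, κ ≠ l → LinReproSum n (colOf K κ l) 0)
    (hwA : ∀ κ l : Fin 4, AbsMoment₂ (colOf K κ l))
    (hS : LocStencil S Cs δs) (hδs : 0 < δs) (hScov : ∀ κ u t, S κ (u + (n : ℤ) • t) = shiftK (-((n : ℤ) • t)) (S κ u))
    (hW : ∀ κ' u l' u', BiLoc (Wf κ' u l' u') u u' C2 δ2) (hδ2 : 0 < δ2)
    (hWcov : ∀ κ' u l' u' t, Wf κ' (u + (n : ℤ) • t) l' (u' + (n : ℤ) • t) = shiftK (-((n : ℤ) • t)) (Wf κ' u l' u'))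
    (hWsymm : ∀ (κ' : Fin 4) (u : Site 4) (l' : Fin 4) (u' : Site 4), Wf κ' u l' u' = Wf l' u' κ' u)
    (hdiv : ∀ (e : Fin 4) (u' u : Site 4), ∑ c : Fin 4,
      (fineHessA (axDressK n K) (coProj n S) Wf c e (u - Pi.single c 1) u' - fineHessA (axDressK n K) (coProj n S) Wf c e u u') = 0)
    (μ ν : Fin 4) :
    ∑' z : Site 4, TPerfOf n K S (vertex2OfK K n Wf) μ ν z * (z μ : ℝ) * (z ν : ℝ)
      = ((n : ℝ) ^ 8)⁻¹ * avgM2 n (fineHessA (axDressK n K) (coProj n S) Wf μ ν) μ ν := by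
  have hn' : (n : ℝ) ^ 8 ≠ 0 := pow_ne_zero 8 (by exact_mod_cast (show n ≠ 0 by omega))
  have h := bondSecondMoment_TPerfOf_eq_avgM2_of_divFree hn hK hδ hKcov hw0 hw1 hw1off hwA hS hδs hScov hW hδ2 hWcov hWsymm hdiv
    (κ := μ) (lam := ν) (μ := μ) (ν := ν) (Or.inl rfl) (Or.inr rfl)
  have e : (fun z : Site 4 => ((z μ * z ν : ℤ) : ℝ) * ((n : ℝ) ^ 8 * TPerfOf n K S (vertex2OfK K n Wf) μ ν z))
      = fun z => (n : ℝ) ^ 8 * (TPerfOf n K S (vertex2OfK K n Wf) μ ν z * (z μ : ℝ) * (z ν : ℝ)) := by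
    funext z; push_cast; ring
  rw [e, tsum_mul_left] at h
  rw [← h, ← mul_assoc, inv_mul_cancel₀ hn', one_mul]

end Transport

/-! ## §2 The perfect resolvent: every K-side hypothesis — INCLUDING the Kronecker row — discharged from the tree -/

section Perfect

variable {Lc : ℕ} [NeZero Lc]

/-- [folklore] **ALG-2b AT THE PERFECT RESOLVENT, AT THE ROAD'S ENTRY, K-SIDE HYPOTHESIS-FREE AND `hT1`-FREE** (`d = 3`, `2 ≤ Lc`, `m ≥ 1`, `n := Lc^m`,
`K := KPerf Lc (sfStep Lc) (smStep 3 Lc) m`; decay `exists_decays_KPerf_holds`, coarse invariance `shiftK_KPerf`, column letters `entryHyps_perfCol_zero`,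
Kronecker row `linReproSum_perfCol_offDiag_holds` — all BY NAME): for ANY local coarse-covariant stencil family `S` and ANY bi-localised coarse-covariant
symmetric bi-table `Wf` whose FULL fine kernel is divergence-free in the first bond,
`Σ'_z TPerfOf n K S (vertex2OfK K n Wf) μ ν z · z_μ · z_ν = n⁻⁸ · avgM2 n (fineHessA (Π K Π) (Πᵀ S) Wf μ ν) μ ν`. -/
theorem secondMoment_TPerfOf_perfect_eq_of_divFree (hLc : 2 ≤ Lc) {m : ℕ} (hm : 1 ≤ m)
    {S : Fin (3 + 1) → (Fin (3 + 1) → ℤ) → MKer (3 + 1) (Fib 3)} {Cs δs : ℝ} (hS : LocStencil S Cs δs) (hδs : 0 < δs)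
    (hScov : ∀ κ u t, S κ (u + ((Lc ^ m : ℕ) : ℤ) • t) = shiftK (-(((Lc ^ m : ℕ) : ℤ) • t)) (S κ u))
    {Wf : Fin (3 + 1) → (Fin (3 + 1) → ℤ) → Fin (3 + 1) → (Fin (3 + 1) → ℤ) → MKer (3 + 1) (Fib 3)} {C2 δ2 : ℝ}
    (hW : ∀ κ' u l' u', BiLoc (Wf κ' u l' u') u u' C2 δ2) (hδ2 : 0 < δ2)
    (hWcov : ∀ κ' u l' u' t, Wf κ' (u + ((Lc ^ m : ℕ) : ℤ) • t) l' (u' + ((Lc ^ m : ℕ) : ℤ) • t)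
      = shiftK (-(((Lc ^ m : ℕ) : ℤ) • t)) (Wf κ' u l' u'))
    (hWsymm : ∀ (κ' : Fin 4) (u : Site 4) (l' : Fin 4) (u' : Site 4), Wf κ' u l' u' = Wf l' u' κ' u)
    (hdiv : ∀ (e : Fin 4) (u' u : Site 4), ∑ c : Fin 4,
      (fineHessA (axDressK (Lc ^ m) (KPerf (d := 3) Lc (sfStep Lc) (smStep 3 Lc) m)) (coProj (Lc ^ m) S) Wf c e (u - Pi.single c 1) u'
        - fineHessA (axDressK (Lc ^ m) (KPerf (d := 3) Lc (sfStep Lc) (smStep 3 Lc) m)) (coProj (Lc ^ m) S) Wf c e u u') = 0)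
    (μ ν : Fin 4) :
    ∑' z : Site 4, TPerfOf (Lc ^ m) (KPerf (d := 3) Lc (sfStep Lc) (smStep 3 Lc) m) S
        (vertex2OfK (KPerf (d := 3) Lc (sfStep Lc) (smStep 3 Lc) m) (Lc ^ m) Wf) μ ν z * (z μ : ℝ) * (z ν : ℝ)
      = ((((Lc ^ m : ℕ) : ℝ)) ^ 8)⁻¹ *
          avgM2 (Lc ^ m) (fineHessA (axDressK (Lc ^ m) (KPerf (d := 3) Lc (sfStep Lc) (smStep 3 Lc) m)) (coProj (Lc ^ m) S) Wf μ ν)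
            μ ν := by
  have hn : 1 ≤ Lc ^ m := Nat.one_le_pow _ _ (by omega)
  obtain ⟨CK, δK, hδK, hK⟩ := exists_decays_KPerf_holds hLc hm
  have hE := entryHyps_perfCol_zero hLc hm
  have h := secondMoment_TPerfOf_vertex2OfK_eq_of_divFree (n := Lc ^ m) hn hK hδK (fun t => shiftK_KPerf Lc (sfStep Lc) (smStep 3 Lc) m t)
    hE.const hE.lin (fun κ l hκl => linReproSum_perfCol_offDiag_holds hLc hm hκl) hE.absW hS hδs (by exact_mod_cast hScov) hW hδ2
    (by exact_mod_cast hWcov) hWsymm hdiv μ ν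
  simpa using h

/-- [folklore] **THE PERFECT COEFFICIENT IN THE `_avg` END's CURRENCY, K-SIDE HYPOTHESIS-FREE AND `hT1`-FREE** (`K := KPerf …`, `n := Lc^m`):
`secondMoment (TPerfOf n K S (vertex2OfK K n Wf)) μ ν = Σ_{b ∈ resSite''} n⁻⁴ · fullSum (w ↦ n⁻⁸·w_μ w_ν·fineHessA (Π K Π) (Πᵀ S) Wf μ ν (b+w) b)` —
`PerfectRepBasePoint.secondMoment_TPerfOf_perfect_eq_basePoint` (= the first twelve binders of the owner's `FP/RepSeam.hrep_perfect_of_rows`) with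
`hrow` + `hT1` REPLACED by first-bond divergence-freeness `hdiv`. -/
theorem secondMoment_TPerfOf_perfect_eq_basePoint_of_divFree (hLc : 2 ≤ Lc) {m : ℕ} (hm : 1 ≤ m)
    {S : Fin (3 + 1) → (Fin (3 + 1) → ℤ) → MKer (3 + 1) (Fib 3)} {Cs δs : ℝ} (hS : LocStencil S Cs δs) (hδs : 0 < δs)
    (hScov : ∀ κ u t, S κ (u + ((Lc ^ m : ℕ) : ℤ) • t) = shiftK (-(((Lc ^ m : ℕ) : ℤ) • t)) (S κ u))
    {Wf : Fin (3 + 1) → (Fin (3 + 1) → ℤ) → Fin (3 + 1) → (Fin (3 + 1) → ℤ) → MKer (3 + 1) (Fib 3)} {C2 δ2 : ℝ}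
    (hW : ∀ κ' u l' u', BiLoc (Wf κ' u l' u') u u' C2 δ2) (hδ2 : 0 < δ2)
    (hWcov : ∀ κ' u l' u' t, Wf κ' (u + ((Lc ^ m : ℕ) : ℤ) • t) l' (u' + ((Lc ^ m : ℕ) : ℤ) • t)
      = shiftK (-(((Lc ^ m : ℕ) : ℤ) • t)) (Wf κ' u l' u'))
    (hWsymm : ∀ (κ' : Fin 4) (u : Site 4) (l' : Fin 4) (u' : Site 4), Wf κ' u l' u' = Wf l' u' κ' u)
    (hdiv : ∀ (e : Fin 4) (u' u : Site 4), ∑ c : Fin 4,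
      (fineHessA (axDressK (Lc ^ m) (KPerf (d := 3) Lc (sfStep Lc) (smStep 3 Lc) m)) (coProj (Lc ^ m) S) Wf c e (u - Pi.single c 1) u'
        - fineHessA (axDressK (Lc ^ m) (KPerf (d := 3) Lc (sfStep Lc) (smStep 3 Lc) m)) (coProj (Lc ^ m) S) Wf c e u u') = 0)
    (μ ν : Fin 4) :
    B12Beta.secondMoment (TPerfOf (Lc ^ m) (KPerf (d := 3) Lc (sfStep Lc) (smStep 3 Lc) m) S
        (vertex2OfK (KPerf (d := 3) Lc (sfStep Lc) (smStep 3 Lc) m) (Lc ^ m) Wf)) μ ν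
      = ∑ b ∈ (univ : Finset (Fin 4 → Fin (Lc ^ m))).image resSite, ((((Lc ^ m : ℕ) : ℝ)) ^ 4)⁻¹ *
          fullSum (fun w : Pt => ((((Lc ^ m : ℕ) : ℝ)) ^ 8)⁻¹ * (toReal w μ * toReal w ν *
            baseKer (fineHessA (axDressK (Lc ^ m) (KPerf (d := 3) Lc (sfStep Lc) (smStep 3 Lc) m)) (coProj (Lc ^ m) S) Wf μ ν) b w)) := by
  have hn : 1 ≤ Lc ^ m := Nat.one_le_pow _ _ (by omega)
  obtain ⟨CK, δK, hδK, hK⟩ := exists_decays_KPerf_holds hLc hm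
  have hA : Spr (axDressK (Lc ^ m) (KPerf (d := 3) Lc (sfStep Lc) (smStep 3 Lc) m)) := ⟨_, δK, hδK, decays_axDressK hn hK hδK.le⟩
  have hmin : 0 < min δs δ2 := lt_min hδs hδ2
  have hS' : ∀ κ u, BiLoc (coProj (Lc ^ m) S κ u) u u (|cN' 3 (Lc ^ m) δs * Cs|) (min δs δ2) := fun κ u =>
    biLoc_of_le (locStencil_coProj hn hS hδs.le κ u) (min_le_left _ _)
  have hW' : ∀ κ' u l' u', BiLoc (Wf κ' u l' u') u u' (|C2|) (min δs δ2) := fun κ' u l' u' =>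
    biLoc_of_le (hW κ' u l' u') (min_le_right _ _)
  unfold B12Beta.secondMoment
  rw [secondMoment_TPerfOf_perfect_eq_of_divFree hLc hm hS hδs hScov hW hδ2 hWcov hWsymm hdiv μ ν]
  exact inv_mul_avgM2_eq_sum_fullSum _ (fun r => absMoment₂_baseKer_fineHessA _ hA hS' hW' hmin μ ν (resSite r)) μ ν

end Perfect

end Summit.QuantumFields.BalabanUV.Beta.FP.PerfectSandwichWard

end
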